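import Mathlib
import Summits.Ventures.PercRepro2.CoinOrTailKDefs
import Summits.Ventures.PercRepro2.CoinOrTailKSums
import Summits.Ventures.PercRepro2.CoinOrTailKAlg
import Summits.Ventures.PercRepro2.CoinOrTailKCore

/-!
# The k-entry OR-tail with ONE entry not covered by the markers: the split by its effective coin
and the pointwise lattice steps (blind cell PercRepro2, night-2 g11; proofs/NIGHT2-DARC.md §43)

For an entry `r₀ ∈ ent` the tail weight factors as
`tailWtK ent W = (1 − ρ₀·1[r₀ ∈ W]) · tailWtK (ent.erase r₀) W` (`tailWtK_erase`), so the tail-mixed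
values split into a CLOSED part (the OR-tail with the entry set `ent.erase r₀`) and an OPEN part
(the tail surely entered — the sure values `A (W ∪ {a})`, `A (W ∪ {a, w})`):
`rValK_split`, `gValK_split`.  The coin factors `1 − ρ₀·1[r₀ ∈ W]` (closed) and `ρ₀·1[r₀ ∈ W]`
(open) satisfy the lattice relations «closed at the meet, open at the join»
(`coinClosed_mul_coinClosed`, `coinOpen_mul_coinOpen`, `coinClosed_mul_coinOpen_le`,
`coinOpen_mul_coinClosed_le`), and the values satisfy the three mixed/sure Ahlswede–Daykin steps
`mixVal_mul_sure_le`, `sure_mul_mixVal_le`, `sure_mul_sure_le` (one log-supermodular step of the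
head `A` followed by a monotone step; `X' ⊆ X` in the meet slot as in `mixValK_mul_le_all`).
-/

namespace Summit.Ventures.PercRepro2.Coin

open Classical

section TailSplit

variable {V : Type*} {E : Type*} [DecidableEq V] {R : Type*} [Field R] [LinearOrder R]
  [IsStrictOrderedRing R]

/-- The tail weight is antitone in the cluster. -/
lemma tailWtK_anti {pr : E → R} (hp0 : ∀ e, 0 ≤ pr e) (hp1 : ∀ e, pr e ≤ 1) (ent : Finset V)
    (c : V → E) {s t : Finset V} (hst : s ⊆ t) : tailWtK pr ent c t ≤ tailWtK pr ent c s := by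
  unfold tailWtK
  apply Finset.prod_le_prod
  · intro r _
    have := hp1 (c r)
    split_ifs <;> linarith
  · intro r _
    have h0 := hp0 (c r)
    by_cases hs : r ∈ s
    · have ht : r ∈ t := hst hs
      simp only [hs, ht, if_true, le_refl]
    · by_cases ht : r ∈ t
      · simp only [hs, ht, if_true, if_false, mul_one, mul_zero, sub_zero]
        linarith
      · simp only [hs, ht, if_false, mul_zero, sub_zero, le_refl]

omit [LinearOrder R] [IsStrictOrderedRing R] in
/-- The tail weight splits off the entry `r₀`. -/
lemma tailWtK_erase (pr : E → R) {ent : Finset V} (c : V → E) {r₀ : V} (hr₀ : r₀ ∈ ent)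
    (W : Finset V) :
    tailWtK pr ent c W =
      (1 - pr (c r₀) * (if r₀ ∈ W then 1 else 0)) * tailWtK pr (ent.erase r₀) c W := by
  unfold tailWtK
  exact (Finset.mul_prod_erase ent (fun r => 1 - pr (c r) * (if r ∈ W then 1 else 0)) hr₀).symm

omit [LinearOrder R] [IsStrictOrderedRing R] in
/-- **The `R`-value splits by the effective coin of `r₀`**: closed (the entry set without `r₀`) or
open (the sure value `A (W ∪ {a})`). -/
lemma rValK_split (A : Finset V → R) (pr : E → R) {ent : Finset V} (c : V → E) (a : V) {r₀ : V}
    (hr₀ : r₀ ∈ ent) (W : Finset V) :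
    rValK A pr ent c a W =
      (1 - pr (c r₀) * (if r₀ ∈ W then 1 else 0)) * rValK A pr (ent.erase r₀) c a W +
        pr (c r₀) * (if r₀ ∈ W then 1 else 0) * A (W ∪ {a}) := by
  unfold rValK
  rw [tailWtK_erase pr c hr₀ W]
  ring

omit [LinearOrder R] [IsStrictOrderedRing R] in
/-- **The gate value splits by the effective coin of `r₀`**. -/
lemma gValK_split (A : Finset V → R) (pr : E → R) {ent : Finset V} (c : V → E) (a w : V) {r₀ : V}
    (hr₀ : r₀ ∈ ent) (W : Finset V) :
    gValK A pr ent c a w W =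
      (1 - pr (c r₀) * (if r₀ ∈ W then 1 else 0)) * gValK A pr (ent.erase r₀) c a w W +
        pr (c r₀) * (if r₀ ∈ W then 1 else 0) * A (W ∪ {a, w}) := by
  unfold gValK
  rw [tailWtK_erase pr c hr₀ W]
  ring

end TailSplit

section CoinFactors

variable {V : Type*} [DecidableEq V] {R : Type*} [Field R] [LinearOrder R] [IsStrictOrderedRing R]

omit [LinearOrder R] [IsStrictOrderedRing R] in
/-- The indicator of a meet is the product of the indicators. -/
lemma ind_inter (r₀ : V) (s t : Finset V) :
    (if r₀ ∈ s ∩ t then (1 : R) else 0) = (if r₀ ∈ s then 1 else 0) * (if r₀ ∈ t then 1 else 0) := by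
  by_cases hs : r₀ ∈ s <;> by_cases ht : r₀ ∈ t <;> simp [hs, ht]

omit [LinearOrder R] [IsStrictOrderedRing R] in
/-- The indicator of a join is `x + y − xy`. -/
lemma ind_union (r₀ : V) (s t : Finset V) :
    (if r₀ ∈ s ∪ t then (1 : R) else 0) =
      (if r₀ ∈ s then 1 else 0) + (if r₀ ∈ t then 1 else 0) -
        (if r₀ ∈ s then 1 else 0) * (if r₀ ∈ t then 1 else 0) := by
  by_cases hs : r₀ ∈ s <;> by_cases ht : r₀ ∈ t <;> simp [hs, ht]

omit [LinearOrder R] [IsStrictOrderedRing R] in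
/-- An indicator is `0` or `1`. -/
lemma ind_zero_or_one (r₀ : V) (s : Finset V) :
    (if r₀ ∈ s then (1 : R) else 0) = 0 ∨ (if r₀ ∈ s then (1 : R) else 0) = 1 := by
  split_ifs <;> simp

/-- The closed coin factor is nonnegative. -/
lemma coinClosed_nonneg {p : R} (hp1 : p ≤ 1) (r₀ : V) (W : Finset V) :
    0 ≤ 1 - p * (if r₀ ∈ W then 1 else 0) := by
  split_ifs <;> linarith

/-- The open coin factor is nonnegative. -/
lemma coinOpen_nonneg {p : R} (hp0 : 0 ≤ p) (r₀ : V) (W : Finset V) :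
    0 ≤ p * (if r₀ ∈ W then 1 else 0) := by
  split_ifs <;> linarith

omit [LinearOrder R] [IsStrictOrderedRing R] in
/-- Closed × closed is log-modular. -/
lemma coinClosed_mul_coinClosed (p : R) (r₀ : V) (s t : Finset V) :
    (1 - p * (if r₀ ∈ s then 1 else 0)) * (1 - p * (if r₀ ∈ t then 1 else 0)) =
      (1 - p * (if r₀ ∈ s ∩ t then 1 else 0)) * (1 - p * (if r₀ ∈ s ∪ t then 1 else 0)) := by
  rw [ind_inter, ind_union]
  rcases ind_zero_or_one (R := R) r₀ s with hx | hx <;>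
    rcases ind_zero_or_one (R := R) r₀ t with hy | hy <;> rw [hx, hy] <;> ring

omit [LinearOrder R] [IsStrictOrderedRing R] in
/-- Open × open is log-modular. -/
lemma coinOpen_mul_coinOpen (p : R) (r₀ : V) (s t : Finset V) :
    (p * (if r₀ ∈ s then 1 else 0)) * (p * (if r₀ ∈ t then 1 else 0)) =
      (p * (if r₀ ∈ s ∩ t then 1 else 0)) * (p * (if r₀ ∈ s ∪ t then 1 else 0)) := by
  rw [ind_inter, ind_union]
  rcases ind_zero_or_one (R := R) r₀ s with hx | hx <;>
    rcases ind_zero_or_one (R := R) r₀ t with hy | hy <;> rw [hx, hy] <;> ring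

/-- Closed × open: closed at the meet, open at the join. -/
lemma coinClosed_mul_coinOpen_le {p : R} (hp0 : 0 ≤ p) (r₀ : V) (s t : Finset V) :
    (1 - p * (if r₀ ∈ s then 1 else 0)) * (p * (if r₀ ∈ t then 1 else 0)) ≤
      (1 - p * (if r₀ ∈ s ∩ t then 1 else 0)) * (p * (if r₀ ∈ s ∪ t then 1 else 0)) := by
  rw [ind_inter, ind_union]
  rcases ind_zero_or_one (R := R) r₀ s with hx | hx <;>
    rcases ind_zero_or_one (R := R) r₀ t with hy | hy <;> rw [hx, hy] <;> nlinarith [hp0]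

/-- Open × closed: closed at the meet, open at the join. -/
lemma coinOpen_mul_coinClosed_le {p : R} (hp0 : 0 ≤ p) (r₀ : V) (s t : Finset V) :
    (p * (if r₀ ∈ s then 1 else 0)) * (1 - p * (if r₀ ∈ t then 1 else 0)) ≤
      (1 - p * (if r₀ ∈ s ∩ t then 1 else 0)) * (p * (if r₀ ∈ s ∪ t then 1 else 0)) := by
  rw [ind_inter, ind_union]
  rcases ind_zero_or_one (R := R) r₀ s with hx | hx <;>
    rcases ind_zero_or_one (R := R) r₀ t with hy | hy <;> rw [hx, hy] <;> nlinarith [hp0]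

end CoinFactors

section ValueSteps

variable {V : Type*} {E : Type*} [DecidableEq V] {R : Type*} [Field R] [LinearOrder R]
  [IsStrictOrderedRing R]

/-- Sure × sure: `A (s ∪ X) · A (t ∪ Y) ≤ A (s ∩ t ∪ X') · A (s ∪ t ∪ X)` for `X' ⊆ Y ⊆ X`. -/
lemma sure_mul_sure_le {A : Finset V → R} (hA0 : ∀ W, 0 ≤ A W)
    (hA : ∀ s t : Finset V, A s * A t ≤ A (s ∩ t) * A (s ∪ t))
    (hmono : ∀ s t : Finset V, s ⊆ t → A t ≤ A s) {X Y X' : Finset V} (hX'Y : X' ⊆ Y)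
    (hYX : Y ⊆ X) (s t : Finset V) : A (s ∪ X) * A (t ∪ Y) ≤ A (s ∩ t ∪ X') * A (s ∪ t ∪ X) := by
  have h1 := hA (s ∪ X) (t ∪ Y)
  have hsub : s ∩ t ∪ X' ⊆ (s ∪ X) ∩ (t ∪ Y) := by
    intro x hx
    simp only [Finset.mem_union, Finset.mem_inter] at hx ⊢
    rcases hx with ⟨h1, h2⟩ | h3
    · exact ⟨Or.inl h1, Or.inl h2⟩
    · exact ⟨Or.inr (hYX (hX'Y h3)), Or.inr (hX'Y h3)⟩
  have heq : (s ∪ X) ∪ (t ∪ Y) = s ∪ t ∪ X := by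
    ext x
    simp only [Finset.mem_union]
    constructor
    · rintro ((h | h) | (h | h))
      · exact Or.inl (Or.inl h)
      · exact Or.inr h
      · exact Or.inl (Or.inr h)
      · exact Or.inr (hYX h)
    · rintro ((h | h) | h)
      · exact Or.inl (Or.inl h)
      · exact Or.inr (Or.inl h)
      · exact Or.inl (Or.inr h)
  rw [heq] at h1
  calc A (s ∪ X) * A (t ∪ Y) ≤ A ((s ∪ X) ∩ (t ∪ Y)) * A (s ∪ t ∪ X) := h1
    _ ≤ A (s ∩ t ∪ X') * A (s ∪ t ∪ X) :=
        mul_le_mul_of_nonneg_right (hmono _ _ hsub) (hA0 _)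

/-- Plain × sure: `A s · A (t ∪ X) ≤ A (s ∩ t) · A (s ∪ t ∪ X)`. -/
lemma plain_mul_sure_le {A : Finset V → R} (hA0 : ∀ W, 0 ≤ A W)
    (hA : ∀ s t : Finset V, A s * A t ≤ A (s ∩ t) * A (s ∪ t))
    (hmono : ∀ s t : Finset V, s ⊆ t → A t ≤ A s) (X s t : Finset V) :
    A s * A (t ∪ X) ≤ A (s ∩ t) * A (s ∪ t ∪ X) := by
  have h1 := hA s (t ∪ X)
  have hsub : s ∩ t ⊆ s ∩ (t ∪ X) :=
    Finset.inter_subset_inter (Finset.Subset.refl s) Finset.subset_union_left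
  rw [← Finset.union_assoc] at h1
  calc A s * A (t ∪ X) ≤ A (s ∩ (t ∪ X)) * A (s ∪ t ∪ X) := h1
    _ ≤ A (s ∩ t) * A (s ∪ t ∪ X) := mul_le_mul_of_nonneg_right (hmono _ _ hsub) (hA0 _)

/-- Sure × plain: `A (s ∪ X) · A t ≤ A (s ∩ t) · A (s ∪ t ∪ X)`. -/
lemma sure_mul_plain_le {A : Finset V → R} (hA0 : ∀ W, 0 ≤ A W)
    (hA : ∀ s t : Finset V, A s * A t ≤ A (s ∩ t) * A (s ∪ t))
    (hmono : ∀ s t : Finset V, s ⊆ t → A t ≤ A s) (X s t : Finset V) :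
    A (s ∪ X) * A t ≤ A (s ∩ t) * A (s ∪ t ∪ X) := by
  have h1 := hA (s ∪ X) t
  have hsub : s ∩ t ⊆ (s ∪ X) ∩ t :=
    Finset.inter_subset_inter Finset.subset_union_left (Finset.Subset.refl t)
  have heq : s ∪ X ∪ t = s ∪ t ∪ X := by
    rw [Finset.union_assoc, Finset.union_comm X t, ← Finset.union_assoc]
  rw [heq] at h1
  calc A (s ∪ X) * A t ≤ A ((s ∪ X) ∩ t) * A (s ∪ t ∪ X) := h1
    _ ≤ A (s ∩ t) * A (s ∪ t ∪ X) := mul_le_mul_of_nonneg_right (hmono _ _ hsub) (hA0 _)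

/-- **Mixed × sure**: the tail-mixed value at `s` against the sure value at `t`, `X' ⊆ X` in the
meet slot. -/
theorem mixVal_mul_sure_le {A : Finset V → R} {pr : E → R} (hp0 : ∀ e, 0 ≤ pr e)
    (hp1 : ∀ e, pr e ≤ 1) (hA0 : ∀ W, 0 ≤ A W)
    (hA : ∀ s t : Finset V, A s * A t ≤ A (s ∩ t) * A (s ∪ t))
    (hmono : ∀ s t : Finset V, s ⊆ t → A t ≤ A s) (ent : Finset V) (c : V → E)
    {X X' : Finset V} (hX' : X' ⊆ X) (s t : Finset V) :
    (tailWtK pr ent c s * A s + (1 - tailWtK pr ent c s) * A (s ∪ X)) * A (t ∪ X) ≤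
      (tailWtK pr ent c (s ∩ t) * A (s ∩ t) + (1 - tailWtK pr ent c (s ∩ t)) * A (s ∩ t ∪ X')) *
        A (s ∪ t ∪ X) := by
  have h1 := plain_mul_sure_le hA0 hA hmono X s t
  have h2 := sure_mul_sure_le hA0 hA hmono hX' (Finset.Subset.refl X) s t
  have hw0 := tailWtK_nonneg hp1 ent c s
  have hw1 := tailWtK_le_one hp0 hp1 ent c s
  have hanti := tailWtK_anti hp0 hp1 ent c (Finset.inter_subset_left : s ∩ t ⊆ s)
  have hAm : A (s ∩ t ∪ X') ≤ A (s ∩ t) := hmono _ _ Finset.subset_union_left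
  have hA3 := hA0 (s ∪ t ∪ X)
  have key : (tailWtK pr ent c s * A s + (1 - tailWtK pr ent c s) * A (s ∪ X)) * A (t ∪ X) ≤
      (tailWtK pr ent c s * A (s ∩ t) + (1 - tailWtK pr ent c s) * A (s ∩ t ∪ X')) *
        A (s ∪ t ∪ X) := by
    have e1 : tailWtK pr ent c s * (A s * A (t ∪ X)) ≤
        tailWtK pr ent c s * (A (s ∩ t) * A (s ∪ t ∪ X)) := mul_le_mul_of_nonneg_left h1 hw0
    have e2 : (1 - tailWtK pr ent c s) * (A (s ∪ X) * A (t ∪ X)) ≤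
        (1 - tailWtK pr ent c s) * (A (s ∩ t ∪ X') * A (s ∪ t ∪ X)) :=
      mul_le_mul_of_nonneg_left h2 (by linarith)
    nlinarith [e1, e2]
  have step : (tailWtK pr ent c s * A (s ∩ t) + (1 - tailWtK pr ent c s) * A (s ∩ t ∪ X')) ≤
      (tailWtK pr ent c (s ∩ t) * A (s ∩ t) + (1 - tailWtK pr ent c (s ∩ t)) * A (s ∩ t ∪ X')) := by
    nlinarith [mul_nonneg (sub_nonneg.2 hanti) (sub_nonneg.2 hAm)]
  exact key.trans (mul_le_mul_of_nonneg_right step hA3)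

/-- **Sure × mixed**: the sure value at `s` against the tail-mixed value at `t`, `X' ⊆ X`. -/
theorem sure_mul_mixVal_le {A : Finset V → R} {pr : E → R} (hp0 : ∀ e, 0 ≤ pr e)
    (hp1 : ∀ e, pr e ≤ 1) (hA0 : ∀ W, 0 ≤ A W)
    (hA : ∀ s t : Finset V, A s * A t ≤ A (s ∩ t) * A (s ∪ t))
    (hmono : ∀ s t : Finset V, s ⊆ t → A t ≤ A s) (ent : Finset V) (c : V → E)
    {X X' : Finset V} (hX' : X' ⊆ X) (s t : Finset V) :
    A (s ∪ X) * (tailWtK pr ent c t * A t + (1 - tailWtK pr ent c t) * A (t ∪ X')) ≤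
      (tailWtK pr ent c (s ∩ t) * A (s ∩ t) + (1 - tailWtK pr ent c (s ∩ t)) * A (s ∩ t ∪ X')) *
        A (s ∪ t ∪ X) := by
  have h1 := sure_mul_plain_le hA0 hA hmono X s t
  have h2 := sure_mul_sure_le hA0 hA hmono (Finset.Subset.refl X') hX' s t
  have hw0 := tailWtK_nonneg hp1 ent c t
  have hw1 := tailWtK_le_one hp0 hp1 ent c t
  have hanti := tailWtK_anti hp0 hp1 ent c (Finset.inter_subset_right : s ∩ t ⊆ t)
  have hAm : A (s ∩ t ∪ X') ≤ A (s ∩ t) := hmono _ _ Finset.subset_union_left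
  have hA3 := hA0 (s ∪ t ∪ X)
  have key : A (s ∪ X) * (tailWtK pr ent c t * A t + (1 - tailWtK pr ent c t) * A (t ∪ X')) ≤
      (tailWtK pr ent c t * A (s ∩ t) + (1 - tailWtK pr ent c t) * A (s ∩ t ∪ X')) *
        A (s ∪ t ∪ X) := by
    have e1 : tailWtK pr ent c t * (A (s ∪ X) * A t) ≤
        tailWtK pr ent c t * (A (s ∩ t) * A (s ∪ t ∪ X)) := mul_le_mul_of_nonneg_left h1 hw0
    have e2 : (1 - tailWtK pr ent c t) * (A (s ∪ X) * A (t ∪ X')) ≤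
        (1 - tailWtK pr ent c t) * (A (s ∩ t ∪ X') * A (s ∪ t ∪ X)) :=
      mul_le_mul_of_nonneg_left h2 (by linarith)
    nlinarith [e1, e2]
  have step : (tailWtK pr ent c t * A (s ∩ t) + (1 - tailWtK pr ent c t) * A (s ∩ t ∪ X')) ≤
      (tailWtK pr ent c (s ∩ t) * A (s ∩ t) + (1 - tailWtK pr ent c (s ∩ t)) * A (s ∩ t ∪ X')) := by
    nlinarith [mul_nonneg (sub_nonneg.2 hanti) (sub_nonneg.2 hAm)]
  exact key.trans (mul_le_mul_of_nonneg_right step hA3)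

end ValueSteps

end Summit.Ventures.PercRepro2.Coin
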